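import Mathlib
import HarnessLib
import Literature.Probability.LatticeModels.AnisotropicTorusSum

/-!
# Route `KLProgramme` — engine support, route (L2′) layer (c): the inverse of the ORDER-TWO product weight is summable on the
# space-time torus, uniformly in `(P, L)` — `Σ_{(j,z)} [Π_{5 directions} (1 + (s·a)⁴)]⁻¹ ≤ C · s₀⁻¹ · (s₂|v|)⁻¹ · (s₃|v|)⁻¹`-type bound

HOME/prover-p4/FRAME-L22-NOTE.md §3′: the `ℓ²` route to `ℓ¹` bounds pairs a weight with FOUR powers of each decay variable (two differences per
direction, squared by Plancherel) — time `j̃`, the two lattice axes `z̃₁, z̃₂`, and the frame directions `ã_{v⊥}, ã_v` of an anisotropic sector —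
and needs `Σ W⁻¹` finite uniformly in the volume.  Here: `(1 + y⁴)⁻¹ ≤ 8(1 + y)⁻⁴` (`inv_one_add_pow_four_le`), products of such factors are
dominated by one isotropic-plus-frame decay factor (`inv_prod_le_inv_pow_sum`), and the lattice sum is bounded by the tree's
`AnisotropicTorusSum.sum_inv_pow_cyclic_le` (time, power 4) and `sum_inv_pow_plane_le` (plane, `m = 7`): **`sum_inv_orderTwoWeight_le`**.
Everything is proved; no definitions, no named facts. [folklore]
-/

noncomputable section

namespace Summit.HubbardSuperconductivity.HubbardSuperconductivity.Theorems.TorusFourierL2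

set_option linter.dupNamespace false -- summit = problem name (single-conjunct summit), D-0017

open Finset Literature.Probability.LatticeModels

/-- `(1 + y⁴)⁻¹ ≤ 8·((1 + y)⁻¹)⁴` for `y ≥ 0`. [folklore] -/
theorem inv_one_add_pow_four_le {y : ℝ} (hy : 0 ≤ y) : (1 + y ^ 4)⁻¹ ≤ 8 * (1 + y)⁻¹ ^ 4 := by
  have h1 : 0 < 1 + y := by linarith
  have h4 : 0 < 1 + y ^ 4 := by positivity
  have hpm : (1 + y) ^ 4 ≤ 8 * (1 + y ^ 4) := by
    nlinarith [sq_nonneg (y - 1), sq_nonneg (y + 1), sq_nonneg (y ^ 2 - 1),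
      mul_nonneg (sq_nonneg (y-1)) (sq_nonneg y), mul_nonneg (sq_nonneg (y - 1)) (sq_nonneg (y + 1))]
  rw [inv_pow, ← div_eq_mul_inv, le_div_iff₀ (by positivity), inv_mul_le_iff₀ h4]
  linarith

/-- **Two directions**: `(1+a⁴)⁻¹(1+b⁴)⁻¹ ≤ 64·((1 + a + b)⁻¹)⁴` for `a, b ≥ 0`. [folklore] -/
theorem inv_mul_inv_le_two {a b : ℝ} (ha : 0 ≤ a) (hb : 0 ≤ b) :
    (1 + a ^ 4)⁻¹ * (1 + b ^ 4)⁻¹ ≤ 64 * (1 + a + b)⁻¹ ^ 4 := by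
  have h1 := inv_one_add_pow_four_le ha
  have h2 := inv_one_add_pow_four_le hb
  have hab : (1 + a)⁻¹ * (1 + b)⁻¹ ≤ (1 + a + b)⁻¹ := by
    rw [← mul_inv, inv_le_inv₀ (by positivity) (by positivity)]
    nlinarith
  have h0 : 0 ≤ (1 + a)⁻¹ * (1 + b)⁻¹ := by positivity
  calc (1 + a ^ 4)⁻¹ * (1 + b ^ 4)⁻¹ ≤ (8 * (1 + a)⁻¹ ^ 4) * (8 * (1 + b)⁻¹ ^ 4) :=
        mul_le_mul h1 h2 (by positivity) (by positivity)
    _ = 64 * ((1 + a)⁻¹ * (1 + b)⁻¹) ^ 4 := by ring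
    _ ≤ 64 * (1 + a + b)⁻¹ ^ 4 := by
        have := pow_le_pow_left₀ h0 hab 4
        linarith

/-- **Four plane directions**: `Π_{i<4} (1+yᵢ⁴)⁻¹ ≤ 8⁴·((1 + Σ yᵢ)⁻¹)⁴` for `yᵢ ≥ 0`. [folklore] -/
theorem inv_prod_four_le {y₁ y₂ y₃ y₄ : ℝ} (h₁ : 0 ≤ y₁) (h₂ : 0 ≤ y₂) (h₃ : 0 ≤ y₃) (h₄ : 0 ≤ y₄) :
    (1 + y₁ ^ 4)⁻¹ * (1 + y₂ ^ 4)⁻¹ * (1 + y₃ ^ 4)⁻¹ * (1 + y₄ ^ 4)⁻¹ ≤ 4096 * (1 + y₁ + y₂ + y₃ + y₄)⁻¹ ^ 4 := by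
  have hA := inv_mul_inv_le_two h₁ h₂
  have hB := inv_mul_inv_le_two h₃ h₄
  have hAB : (1 + y₁ + y₂)⁻¹ * (1 + y₃ + y₄)⁻¹ ≤ (1 + y₁ + y₂ + y₃ + y₄)⁻¹ := by
    rw [← mul_inv, inv_le_inv₀ (by positivity) (by positivity)]
    nlinarith [mul_nonneg (add_nonneg h₁ h₂) (add_nonneg h₃ h₄)]
  have h0 : 0 ≤ (1 + y₁ + y₂)⁻¹ * (1 + y₃ + y₄)⁻¹ := by positivity
  calc (1 + y₁ ^ 4)⁻¹ * (1 + y₂ ^ 4)⁻¹ * (1 + y₃ ^ 4)⁻¹ * (1 + y₄ ^ 4)⁻¹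
        = ((1 + y₁ ^ 4)⁻¹ * (1 + y₂ ^ 4)⁻¹) * ((1 + y₃ ^ 4)⁻¹ * (1 + y₄ ^ 4)⁻¹) := by ring
    _ ≤ (64 * (1 + y₁ + y₂)⁻¹ ^ 4) * (64 * (1 + y₃ + y₄)⁻¹ ^ 4) :=
        mul_le_mul hA hB (by positivity) (by positivity)
    _ = 4096 * ((1 + y₁ + y₂)⁻¹ * (1 + y₃ + y₄)⁻¹) ^ 4 := by ring
    _ ≤ 4096 * (1 + y₁ + y₂ + y₃ + y₄)⁻¹ ^ 4 := by
        have := pow_le_pow_left₀ h0 hAB 4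
        linarith

/-- **The inverse order-two product weight is summable on the space-time torus, uniformly in `(P, L)`.**  For rates `s₀, s₁, s₂, s₃ > 0`, an
integer direction `v ≠ 0` (frame `(v⊥, v)`) and a near radius `R₀` with `2(|v₁|+|v₂|)R₀ < L`:
`Σ_{(j,z)} [(1+(s₀|j̃|)⁴)(1+(s₁|z̃₁|)⁴)(1+(s₁|z̃₂|)⁴)(1+(s₂|ã_{v⊥}(z)|)⁴)(1+(s₃|ã_v(z)|)⁴)]⁻¹
  ≤ 8·32(1/s₀+1) · 4096·[8(2√2/(s₂|v|)+2)(2√2/(s₃|v|)+2) + (1+s₁R₀)⁻¹·32(1/s₁+1)²]` — the `s₀⁻¹·(s₂|v|)⁻¹·(s₃|v|)⁻¹` volume of the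
dual cell plus a far-region term, exactly as in `AnisotropicTorusSum.sum_inv_pow_spaceTimeTorus_le`. [folklore] -/
theorem sum_inv_orderTwoWeight_le {P L : ℕ} [NeZero P] [NeZero L] (v : Fin 2 → ℤ) (hv : v ≠ 0) {s₀ s₁ s₂ s₃ : ℝ}
    (hs₀ : 0 < s₀) (hs₁ : 0 < s₁) (hs₂ : 0 < s₂) (hs₃ : 0 < s₃) {R₀ : ℕ} (hR₀ : 2 * (|v 0| + |v 1|) * (R₀ : ℤ) < L) :
    ∑ q : TorusSite 1 P × TorusSite 2 L,
      ((1 + (s₀ * |(((q.1 0).valMinAbs : ℤ) : ℝ)|) ^ 4) * (1 + (s₁ * |(((q.2 0).valMinAbs : ℤ) : ℝ)|) ^ 4) *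
        (1 + (s₁ * |(((q.2 1).valMinAbs : ℤ) : ℝ)|) ^ 4) *
        (1 + (s₂ * |(((∑ j, ((![-v 1, v 0] j : ℤ) : ZMod L) * q.2 j).valMinAbs : ℤ) : ℝ)|) ^ 4) *
        (1 + (s₃ * |(((∑ j, ((v j : ℤ) : ZMod L) * q.2 j).valMinAbs : ℤ) : ℝ)|) ^ 4))⁻¹ ≤
      (8 * (32 * (1 / s₀ + 1))) * (4096 *
        (8 * ((2 * Real.sqrt 2 / (s₂ * Real.sqrt ((v 0 : ℝ) ^ 2 + (v 1 : ℝ) ^ 2)) + 2) *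
            (2 * Real.sqrt 2 / (s₃ * Real.sqrt ((v 0 : ℝ) ^ 2 + (v 1 : ℝ) ^ 2)) + 2))
          + (1 + s₁ * R₀)⁻¹ ^ (7 - 6) * (32 * (1 / s₁ + 1) ^ 2))) := by
  -- abbreviations for the five decay variables
  set T : TorusSite 1 P → ℝ := fun j => s₀ * |(((j 0).valMinAbs : ℤ) : ℝ)| with hT
  set A₁ : TorusSite 2 L → ℝ := fun z => s₁ * |(((z 0).valMinAbs : ℤ) : ℝ)| with hA₁
  set A₂ : TorusSite 2 L → ℝ := fun z => s₁ * |(((z 1).valMinAbs : ℤ) : ℝ)| with hA₂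
  set B₁ : TorusSite 2 L → ℝ := fun z => s₂ * |(((∑ j, ((![-v 1, v 0] j : ℤ) : ZMod L) * z j).valMinAbs : ℤ) : ℝ)| with hB₁
  set B₂ : TorusSite 2 L → ℝ := fun z => s₃ * |(((∑ j, ((v j : ℤ) : ZMod L) * z j).valMinAbs : ℤ) : ℝ)| with hB₂
  have hT0 : ∀ j, 0 ≤ T j := fun j => by positivity
  have hA₁0 : ∀ z, 0 ≤ A₁ z := fun z => by positivity
  have hA₂0 : ∀ z, 0 ≤ A₂ z := fun z => by positivity
  have hB₁0 : ∀ z, 0 ≤ B₁ z := fun z => by positivity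
  have hB₂0 : ∀ z, 0 ≤ B₂ z := fun z => by positivity
  -- pointwise domination by the product of a time factor and a plane factor
  have hpt : ∀ q : TorusSite 1 P × TorusSite 2 L,
      ((1 + T q.1 ^ 4) * (1 + A₁ q.2 ^ 4) * (1 + A₂ q.2 ^ 4) * (1 + B₁ q.2 ^ 4) * (1 + B₂ q.2 ^ 4))⁻¹ ≤
        (8 * (1 + T q.1)⁻¹ ^ 4) * (4096 * (1 + A₁ q.2 + A₂ q.2 + B₁ q.2 + B₂ q.2)⁻¹ ^ 4) := by
    intro q
    have h1 := inv_one_add_pow_four_le (hT0 q.1)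
    have h2 := inv_prod_four_le (hA₁0 q.2) (hA₂0 q.2) (hB₁0 q.2) (hB₂0 q.2)
    have e : ((1 + T q.1 ^ 4) * (1 + A₁ q.2 ^ 4) * (1 + A₂ q.2 ^ 4) * (1 + B₁ q.2 ^ 4) * (1 + B₂ q.2 ^ 4))⁻¹ =
        (1 + T q.1 ^ 4)⁻¹ * ((1 + A₁ q.2 ^ 4)⁻¹ * (1 + A₂ q.2 ^ 4)⁻¹ * (1 + B₁ q.2 ^ 4)⁻¹ * (1 + B₂ q.2 ^ 4)⁻¹) := by
      rw [mul_inv, mul_inv, mul_inv, mul_inv]; ring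
    rw [e]
    exact mul_le_mul h1 h2 (by positivity) (by positivity)
  -- the two lattice sums
  have htime : ∑ j : TorusSite 1 P, 8 * (1 + T j)⁻¹ ^ 4 ≤ 8 * (32 * (1 / s₀ + 1)) := by
    rw [← Finset.mul_sum]
    exact mul_le_mul_of_nonneg_left (sum_inv_pow_cyclic_le hs₀ (by norm_num)) (by norm_num)
  have hplane : ∑ z : TorusSite 2 L, 4096 * (1 + A₁ z + A₂ z + B₁ z + B₂ z)⁻¹ ^ 4 ≤ 4096 *
      (8 * ((2 * Real.sqrt 2 / (s₂ * Real.sqrt ((v 0 : ℝ) ^ 2 + (v 1 : ℝ) ^ 2)) + 2) *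
          (2 * Real.sqrt 2 / (s₃ * Real.sqrt ((v 0 : ℝ) ^ 2 + (v 1 : ℝ) ^ 2)) + 2))
        + (1 + s₁ * R₀)⁻¹ ^ (7 - 6) * (32 * (1 / s₁ + 1) ^ 2)) := by
    rw [← Finset.mul_sum]
    refine mul_le_mul_of_nonneg_left ?_ (by norm_num)
    have h := sum_inv_pow_plane_le v hv hs₁ hs₂ hs₃ hR₀ (m := 7) (by norm_num)
    refine le_trans (le_of_eq (Finset.sum_congr rfl fun z _ => ?_)) h
    simp only [hA₁, hA₂, hB₁, hB₂]
    congr 1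
    ring
  -- assemble
  calc ∑ q : TorusSite 1 P × TorusSite 2 L,
        ((1 + T q.1 ^ 4) * (1 + A₁ q.2 ^ 4) * (1 + A₂ q.2 ^ 4) * (1 + B₁ q.2 ^ 4) * (1 + B₂ q.2 ^ 4))⁻¹
      ≤ ∑ q : TorusSite 1 P × TorusSite 2 L, (8 * (1 + T q.1)⁻¹ ^ 4) * (4096 * (1 + A₁ q.2 + A₂ q.2 + B₁ q.2 + B₂ q.2)⁻¹ ^ 4) :=
        Finset.sum_le_sum fun q _ => hpt q
    _ = (∑ j : TorusSite 1 P, 8 * (1 + T j)⁻¹ ^ 4) * (∑ z : TorusSite 2 L, 4096 * (1 + A₁ z + A₂ z + B₁ z + B₂ z)⁻¹ ^ 4) := by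
        rw [Fintype.sum_prod_type, Finset.sum_mul]
        refine Finset.sum_congr rfl fun j _ => ?_
        rw [Finset.mul_sum]
    _ ≤ _ := mul_le_mul htime hplane (Finset.sum_nonneg fun z _ => by positivity) (by positivity)

end Summit.HubbardSuperconductivity.HubbardSuperconductivity.Theorems.TorusFourierL2

end
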